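import Literature.NumberTheory.LFunctions.Zhang2022.Section12U025RelHolds
import Literature.NumberTheory.LFunctions.Zhang2022.RepairGapSection12ShiftedContourZ22Premise
import Literature.NumberTheory.LFunctions.Zhang2022.RepairGapSection12ShiftedSmallCircleOmegaPremise
import Literature.NumberTheory.LFunctions.Zhang2022.RepairGapLemma83RelFree
import Literature.NumberTheory.LFunctions.Zhang2022.RepairGapPartIIIDoors
import HarnessLib

/-!
# Zhang (2022), rescue GAP/BED (D-0124 (3)(4)): §12 proof of Lemma 12.2, pp. 69–70 — the steps u024, u025 (relative reading),
# u026 (Cauchy) and (12.10)ᴿ at the rate `O(𝓛⁻¹⁵)` (`Typed.Sec12B.U024Rel / U025Rel / U026readRel / Eq1210L15Rel`) under the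
# minimum premise `‖L(1,χ)‖ ≤ 𝓛⁻¹⁵`, UNCONDITIONAL for every real `c′`

Topic `Literature/NumberTheory/LFunctions/Zhang2022` (Landau–Siegel audit tree; verdict-neutral).
Y. Zhang, *Discrete mean estimates and the Landau–Siegel zero*, arXiv:2211.02515v1 (2022)
[Zhang2022LandauSiegel] — **an unrefereed manuscript under adjudication; nothing in this file asserts or
denies its Theorems 1–2, and nothing here is a claim about Landau–Siegel zeros. The programme SEARCHES and
TYPES; no claim about Landau–Siegel zeros, Theorems 1–2 of arXiv:2211.02515 or a repaired Margin232 until a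
kernel theorem says so.**

The tree closes (12.10)ᴿ — `Typed.Sec12B.Eq1210L15Rel c′`, the input `h10R` of `Typed.Sec12C.eq1212_of_eq1210L15Rel'` (leaf h1212
`Typed.Sec12C.Eq1212`) — by `Section12U025RelHolds`: u024 (`u024Rel_holds`: ψ-free, guard idle), u025 (`u025Rel_of_lemma83Rel`: Perron glue +
the shifted big contour `norm_vline_sub_circ_le_Z22` [exceptional-zero door] + the `ω₁`-circle pair evaluation [Lemma 5.8 / Lemma 5.7 doors] +
`circ025_eq`, over Lemma 8.3 (rel)), then the THREADS `u026readRel_of_u024Rel_u025Rel` (Cauchy's estimate) and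
`eq1210L15Rel_of_u026readRel` (u023, u027, `b*`, `log P₁`) of `Section12RelEdges`. Every door is kernel at (A)-exponent 15
(`Repair.Gap.lemma83Rel_free` p608077; `norm_vline_sub_circ_le_Z22_pow15`, `circ_omega1_pair_eval_forAllLarge_pow15` — this seat), so the four
proofs re-run VERBATIM with the guard text `AssumptionA D χ →` replaced by `‖L(1,χ)‖ ≤ 𝓛⁻¹⁵ →` give **`u024Rel_pow15`**, **`u025Rel_pow15`**,
`u026readRel_pow15_of`, `eq1210L15Rel_pow15_of_u026readRel`, and **`eq1210L15Rel_pow15` — the body of `Eq1210L15Rel c′` at guard `𝓛⁻¹⁵`,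
every real `c′`, UNCONDITIONAL**. Theorems only; no definition, no named fact; nothing about (A) itself. Private helpers of the source files
copied (suffix `_u15`).

## References

* Y. Zhang, arXiv:2211.02515v1 (2022), §12 proof of Lemma 12.2, pp. 69–70 (tex L3528–L3541), (12.10); §8 Lemmas 8.3–8.4; §5 Lemmas 5.5, 5.7, 5.8;
  §4 (4.1). [cite: Zhang2022LandauSiegel, §12 proof of Lemma 12.2, p. 69]
* H. L. Montgomery, R. C. Vaughan, *Multiplicative Number Theory I*, CUP 2007, §6.2, Thm 11.4. [cite: MontgomeryVaughan2007, §6.2]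
-/

noncomputable section

open Complex Real MeasureTheory

namespace Literature.NumberTheory.LFunctions.Zhang2022.Typed.Sec12B

open Literature.NumberTheory.LFunctions.Zhang2022.Skeleton
open Literature.NumberTheory.LFunctions.Zhang2022.GaussWeight

/-- `⌈x⌉₊ ≤ D` gives `x ≤ D` in `ℝ`. [folklore] -/
private theorem le_of_ceil_le_u15 {x : ℝ} {D : ℕ} (h : ⌈x⌉₊ ≤ D) : x ≤ (D : ℝ) :=
  (Nat.le_ceil x).trans (by exact_mod_cast h)


/-! ## u024 at `𝓛⁻¹⁵` (ψ-free; the guard is idle) -/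

/-- **Z22:§12.u024 (relative reading) at (A)-exponent 15, UNCONDITIONAL, every real `c′`** — the body of `Typed.Sec12B.U024Rel c′` with its guard
`AssumptionA D χ` replaced by `‖L(1,χ)‖ ≤ 𝓛⁻¹⁵`: the tree proof of `u024Rel_holds` verbatim (ψ-free `u024Rel` + `r/φ(r) ≤ Π̂(dr)²`; the guard is
bound and never used). [cite: Zhang2022LandauSiegel, §12 proof of Lemma 12.2, p. 69, tex L3528] -/
theorem u024Rel_pow15 (c' : ℝ) :
    ∃ C : ℝ, ForAllLarge fun D _ χ => ‖χ.LFunction 1‖ ≤ 1 / Real.log D ^ 15 →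
      ∀ j ∈ ({1, 2, 3} : Finset ℕ), ∀ d r : ℕ, 1 ≤ d → 1 ≤ r →
        ((d * r : ℕ) : ℝ) ≤ P1pp D / bigT D → ∀ w : ℂ, ‖w‖ = alpha D →
          ‖innerSum c' χ j d r w - gSeries c' χ j d r w‖ ≤
              C * (ell D ^ 15)⁻¹ * (∏ q ∈ (d * r).primeFactors, (1 - (q : ℝ)⁻¹)⁻¹) ^ 2 ∧
          ‖innerSum c' χ j d r w - lineInt024 c' χ j d r w‖ ≤
              C * (ell D ^ 15)⁻¹ * (∏ q ∈ (d * r).primeFactors, (1 - (q : ℝ)⁻¹)⁻¹) ^ 2 := by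
  obtain ⟨C, D₀, h⟩ := u024Rel c'
  refine ⟨max C 0, D₀, fun D _ χ hD hq hp _ j _ d r hd hr hdr w hw => ?_⟩
  have hd0 : d ≠ 0 := by omega
  have hr0 : r ≠ 0 := by omega
  obtain ⟨h1, h2⟩ := h D χ hD hq hp j d r hd hr hdr w hw
  have hρ0 : 0 ≤ (r : ℝ) / r.totient := le_trans zero_le_one (Skeleton.one_le_self_div_totient hr0)
  have hρ : (r : ℝ) / r.totient ≤ (∏ q ∈ (d * r).primeFactors, (1 - (q : ℝ)⁻¹)⁻¹) ^ 2 :=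
    le_trans (self_div_totient_le_prod hd0 hr0) (prod_le_prod_sq _)
  have hL : 0 ≤ (ell D ^ 15)⁻¹ := inv_nonneg.mpr (pow_nonneg (Real.log_natCast_nonneg D) 15)
  have key : ∀ x : ℝ, x ≤ C * (ell D ^ 15)⁻¹ * ((r : ℝ) / r.totient) →
      x ≤ max C 0 * (ell D ^ 15)⁻¹ * (∏ q ∈ (d * r).primeFactors, (1 - (q : ℝ)⁻¹)⁻¹) ^ 2 := by
    intro x hx
    refine le_trans hx ?_
    calc C * (ell D ^ 15)⁻¹ * ((r : ℝ) / r.totient)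
        ≤ max C 0 * (ell D ^ 15)⁻¹ * ((r : ℝ) / r.totient) :=
          mul_le_mul_of_nonneg_right (mul_le_mul_of_nonneg_right (le_max_left _ _) hL) hρ0
      _ ≤ max C 0 * (ell D ^ 15)⁻¹ * (∏ q ∈ (d * r).primeFactors, (1 - (q : ℝ)⁻¹)⁻¹) ^ 2 :=
          mul_le_mul_of_nonneg_left hρ (mul_nonneg (le_max_right _ _) hL)
  exact ⟨key _ h1, key _ h2⟩

/-! ## u025 at `𝓛⁻¹⁵` -/

set_option maxHeartbeats 800000 in
/-- **Z22:§12.u025 (relative reading) at (A)-exponent 15, UNCONDITIONAL, every real `c′`** — the body of `Typed.Sec12B.U025Rel c′` with its guard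
`AssumptionA D χ` replaced by `‖L(1,χ)‖ ≤ 𝓛⁻¹⁵`: the tree assembly `u025Rel_of_lemma83Rel` verbatim over `Repair.Gap.lemma83Rel_free` (Lemma 8.3
(rel) hypothesis-free), the shifted big contour at 15 (`Lemma84.ShiftedContour.norm_vline_sub_circ_le_Z22_pow15`, twice), the `ω₁`-circle pair
evaluation at 15 (`Lemma84.circ_omega1_pair_eval_forAllLarge_pow15`) and the residue identity `circ025_eq`; total `(2C₀ + C)·𝓛⁻¹⁵·Π̂(dr)²`.
[cite: Zhang2022LandauSiegel, §12 proof of Lemma 12.2, p. 69, tex L3528–L3541] [cite: MontgomeryVaughan2007, §6.2] -/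
theorem u025Rel_pow15 (c' : ℝ) :
    ∃ C : ℝ, ForAllLarge fun D _ χ => ‖χ.LFunction 1‖ ≤ 1 / Real.log D ^ 15 →
      ∀ j ∈ ({1, 2, 3} : Finset ℕ), ∀ d r : ℕ, 1 ≤ d → 1 ≤ r →
        ((d * r : ℕ) : ℝ) ≤ P1pp D / bigT D → ∀ w : ℂ, ‖w‖ = alpha D →
          ‖lineInt024 c' χ j d r w - deriv χ.LFunction 1 * PiW χ d r * circ025 c' D j d r w‖ ≤
            C * (ell D ^ 15)⁻¹ * (∏ q ∈ (d * r).primeFactors, (1 - (q : ℝ)⁻¹)⁻¹) ^ 2 := by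
  obtain ⟨C83, D83, h83⟩ := Repair.Gap.lemma83Rel_free c'
  set Cabs : ℝ := |C83| with hCabs
  have hCabs0 : 0 ≤ Cabs := abs_nonneg _
  obtain ⟨C₀, hC₀, D₁, hZ⟩ :=
    Lemma84.ShiftedContour.norm_vline_sub_circ_le_Z22_pow15 (C₈₃ := Cabs) hCabs0 15
  obtain ⟨C₂, hC₂, D₂, hΩ⟩ := Lemma84.circ_omega1_pair_eval_forAllLarge_pow15 c' Cabs
  obtain ⟨D₃, h025⟩ := circ025_eq c'
  refine ⟨2 * C₀ + C₂, max (max D83 D₁) (max (max D₂ D₃) ⌈Real.exp (10 * |c'| * π + 400)⌉₊),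
    fun D _ χ hD hq hp hA j hj d r hd hr hdr w hw => ?_⟩
  -- thresholds
  have hD83 : D83 ≤ D := le_trans (le_trans (le_max_left _ _) (le_max_left _ _)) hD
  have hD₁ : D₁ ≤ D := le_trans (le_trans (le_max_right _ _) (le_max_left _ _)) hD
  have hD₂ : D₂ ≤ D :=
    le_trans (le_trans (le_trans (le_max_left _ _) (le_max_left _ _)) (le_max_right _ _)) hD
  have hD₃ : D₃ ≤ D :=
    le_trans (le_trans (le_trans (le_max_right _ _) (le_max_left _ _)) (le_max_right _ _)) hD
  have hDexp : Real.exp (10 * |c'| * π + 400) ≤ D :=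
    le_of_ceil_le_u15 (le_trans (le_trans (le_max_right _ _) (le_max_right _ _)) hD)
  obtain ⟨hℓ3, hα, hbsum, hαℓ⟩ := Lemma83.largeD_bounds c' hDexp
  have hL3 : 3 ≤ Real.log D := hℓ3
  have hL1 : 1 ≤ Real.log D := by linarith
  have hD0 : (0 : ℝ) < D := lt_of_lt_of_le (Real.exp_pos _) hDexp
  have hD9r : (9 : ℝ) ≤ D := by
    have h := Real.add_one_le_exp (10 * |c'| * π + 400)
    have : 0 ≤ 10 * |c'| * π := by positivity
    linarith
  have hD9 : 9 ≤ D := by exact_mod_cast hD9r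
  have hD3 : 3 ≤ D := le_trans (by norm_num) hD9
  have hD2 : 2 ≤ D := le_trans (by norm_num) hD9
  have hχ1 : χ ≠ 1 := Lemma31.ne_one_of_isPrimitive χ hD2 hp
  have hA' : ‖χ.LFunction 1‖ ≤ 1 / Real.log D ^ 15 := hA
  have hd0 : d ≠ 0 := Nat.one_le_iff_ne_zero.mp hd
  have hr0 : r ≠ 0 := Nat.one_le_iff_ne_zero.mp hr
  have hdr0 : 0 < ((d * r : ℕ) : ℝ) := by exact_mod_cast Nat.pos_of_ne_zero (mul_ne_zero hd0 hr0)
  -- `α`, `β`, `w`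
  have hw' : -1 < w.re := neg_one_lt_re_of_norm_eq_alpha (alpha_lt_one hD9) hw
  have hβa_re : (betaJ c' D (j + 1)).re = 0 := Section8PerronSteps.betaJ_re c' D (j + 1)
  have hβb_re : (betaJ c' D (j + 2)).re = 0 := Section8PerronSteps.betaJ_re c' D (j + 2)
  have hβ_norm : ∀ i : ℕ, ‖betaJ c' D i‖ ≤ 1 / 2 := by
    intro i
    have h1 := Lemma83.norm_betaJ_le c' D i
    have h3 : alpha D ≤ 1 / (112 * 3) := by
      rw [le_div_iff₀ (by norm_num)]
      have : alpha D * 3 ≤ alpha D * ell D := mul_le_mul_of_nonneg_left hℓ3 hα.le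
      nlinarith
    linarith
  -- the shift `s₀ = β₆ − w`
  obtain ⟨-, hs₀norm, -⟩ := Lemma84.center_shift_bounds hα hw
  have hs₀im : (beta6 D - w).im ≠ 0 := (beta6_sub_im_pos (D := D) hα hw).2
  -- the two cut-off points
  set Y₁ : ℝ := P1pp D / ((d * r : ℕ) : ℝ) with hY₁def
  set Y₂ : ℝ := P2pp D / ((d * r : ℕ) : ℝ) with hY₂def
  obtain ⟨⟨hTY₁, hY₁P⟩, ⟨hTY₂, hY₂P⟩⟩ := u025_cutoffs_mem (D := D) hL3 hd0 hr0 hdr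
  have hT1 : 1 ≤ bigT D := by rw [bigT]; exact Real.one_le_exp (by positivity)
  have h1Y₁ : 1 ≤ Y₁ := hT1.trans hTY₁
  have h1Y₂ : 1 ≤ Y₂ := hT1.trans hTY₂
  have hΛ1 : (1 : ℝ) ≤ ell D ^ 30 := one_le_pow₀ (by rw [ell]; exact hL1)
  -- `dr < PT⁻²` (the range of Lemma 8.3) and `log(dr) ≤ 𝓛⁹`
  have hP1lt : P1pp D < P2pp D := by
    have ht0 : 0 < t0 D := by rw [t0]; exact pow_pos (by rw [ell]; linarith) _
    have hP : 1 < bigP D := by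
      rw [bigP]; exact Real.one_lt_exp_iff.mpr (pow_pos (by rw [ell]; linarith) _)
    have hpow : bigP D ^ (0.496 : ℝ) < bigP D ^ (0.5 : ℝ) :=
      Real.rpow_lt_rpow_of_exponent_lt hP (by norm_num)
    unfold P1pp P2pp
    exact mul_lt_mul_of_pos_right (mul_lt_mul_of_pos_right hpow hD0) ht0
  have hdrP1 : ((d * r : ℕ) : ℝ) ≤ P1pp D :=
    hdr.trans (div_le_self (P1pp_pos hD3).le hT1)
  have hdrlt : ((d * r : ℕ) : ℝ) < bigP D / bigT D ^ 2 :=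
    lt_of_lt_of_le (lt_of_le_of_lt hdrP1 hP1lt) (Sec12D.P2pp_le_P_div_T_sq hL3)
  have hlogn : Real.log ((d * r : ℕ) : ℝ) ≤ Real.log D ^ 9 := by
    have h1 : ((d * r : ℕ) : ℝ) ≤ bigP D :=
      hdrP1.trans ((le_of_lt hP1lt).trans (P2pp_le_bigP hL3))
    calc Real.log ((d * r : ℕ) : ℝ) ≤ Real.log (bigP D) := Real.log_le_log hdr0 h1
      _ = Real.log D ^ 9 := by rw [bigP, Real.log_exp, ell]
  -- the continuation `𝔲` of Lemma 8.3 (relative form)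
  obtain ⟨U, hUd, hU2, hUb, hU3⟩ := h83 D χ hD83 hq hp j hj d r hd hr hdrlt
  have hUb' : ∀ s : ℂ, 9 / 10 < s.re →
      ‖U s‖ ≤ Cabs * ∏ q ∈ (d * r).primeFactors, (1 + Cabs * (q : ℝ) ^ (-s.re)) := by
    intro s hs
    calc ‖U s‖ ≤ C83 * ∏ q ∈ (d * r).primeFactors, (1 + C83 * (q : ℝ) ^ (-s.re)) := hUb s hs
      _ ≤ |C83 * ∏ q ∈ (d * r).primeFactors, (1 + C83 * (q : ℝ) ^ (-s.re))| := le_abs_self _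
      _ = Cabs * ∏ q ∈ (d * r).primeFactors, |1 + C83 * (q : ℝ) ^ (-s.re)| := by
          rw [abs_mul, Finset.abs_prod]
      _ ≤ Cabs * ∏ q ∈ (d * r).primeFactors, (1 + Cabs * (q : ℝ) ^ (-s.re)) := by
          refine mul_le_mul_of_nonneg_left ?_ hCabs0
          refine Finset.prod_le_prod (fun _ _ => abs_nonneg _) fun q _ => ?_
          calc |1 + C83 * (q : ℝ) ^ (-s.re)| ≤ |(1 : ℝ)| + |C83 * (q : ℝ) ^ (-s.re)| := abs_add_le _ _
            _ = 1 + Cabs * (q : ℝ) ^ (-s.re) := by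
                rw [abs_one, abs_mul, abs_of_nonneg (Real.rpow_nonneg (Nat.cast_nonneg q) _)]
  have hU3' : ∀ s : ℂ, ‖s - 1‖ ≤ 5 * alpha D → ‖U s - PiW χ d r‖ ≤
      Cabs * (ell D ^ 8)⁻¹ * ∏ q ∈ (d * r).primeFactors, (1 - (q : ℝ)⁻¹)⁻¹ := by
    intro s hs
    refine (hU3 s hs).trans ?_
    have := Literature.NumberTheory.Sieve.GreenTao2008.GYCorr.one_le_prod_one_sub_inv_inv (d * r)
    gcongr
    exact le_abs_self _
  -- the quotient `Φ` of the shifted contour layer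
  set Φ : ℂ → ℂ := fun z => U (1 - beta6 D + w + z) *
      χ.LFunction (1 - beta6 D + w + z + betaJ c' D (j + 1)) *
      χ.LFunction (1 - beta6 D + w + z + betaJ c' D (j + 2)) /
      χ.LFunction (1 - beta6 D + w + z) with hΦdef
  have hΦ : ∀ s, Φ s = U (1 - (beta6 D - w) + s) *
      χ.LFunction (1 - (beta6 D - w) + s + betaJ c' D (j + 1)) *
      χ.LFunction (1 - (beta6 D - w) + s + betaJ c' D (j + 2)) /
      χ.LFunction (1 - (beta6 D - w) + s) := by
    intro s
    rw [hΦdef]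
    simp only []
    rw [show (1 : ℂ) - (beta6 D - w) + s = 1 - beta6 D + w + s by ring]
  -- (1) the Perron glue: `lineInt024 = V(Y₂) − V(Y₁)`
  have hglue := lineInt024_eq_vline_sub c' χ hD3 hd0 hr0 j hw' U Φ hU2 hΦ rfl
  -- (2) the big contour at `Y₂` and at `Y₁`
  have hZ₂ := hZ hD₁ χ hχ1 hA' U Φ (beta6 D - w) (betaJ c' D (j + 1)) (betaJ c' D (j + 2))
    (n := d * r) (Y := Y₂) (mul_ne_zero hd0 hr0) hlogn hUd hUb' hβa_re (hβ_norm _) hβb_re (hβ_norm _)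
    hs₀norm hs₀im hΦ hTY₂ hY₂P
  have hZ₁ := hZ hD₁ χ hχ1 hA' U Φ (beta6 D - w) (betaJ c' D (j + 1)) (betaJ c' D (j + 2))
    (n := d * r) (Y := Y₁) (mul_ne_zero hd0 hr0) hlogn hUd hUb' hβa_re (hβ_norm _) hβb_re (hβ_norm _)
    hs₀norm hs₀im hΦ hTY₁ hY₁P
  -- (3) the small circle (pair form, with `ω₁`)
  have hΩ' := hΩ D χ hD₂ hq hp hA j d r hd0 hr0 U hUd hU3' w hw Y₁ Y₂ h1Y₁ hY₁P h1Y₂ hY₂P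
    (ell D ^ 30) hΛ1
  -- (4) the residue identity
  have h025' := h025 D χ hD₃ hq hp j hj d r hd hr w hw
  -- unfold `Φ` in (1), (2) so that the circle terms are those of (3)
  simp only [hΦdef] at hglue hZ₂ hZ₁
  -- abbreviations
  set V₂ : ℂ := (1 / (2 * π) : ℂ) * (∫ t : ℝ,
      U (1 - beta6 D + w + (((1 : ℝ) : ℂ) + t * I)) *
          χ.LFunction (1 - beta6 D + w + (((1 : ℝ) : ℂ) + t * I) + betaJ c' D (j + 1)) *
          χ.LFunction (1 - beta6 D + w + (((1 : ℝ) : ℂ) + t * I) + betaJ c' D (j + 2)) /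
          χ.LFunction (1 - beta6 D + w + (((1 : ℝ) : ℂ) + t * I)) *
        (((Y₂ : ℝ) : ℂ) ^ (((1 : ℝ) : ℂ) + t * I + 0) * omega1 (ell D ^ 30) (((1 : ℝ) : ℂ) + t * I + 0) /
          (((1 : ℝ) : ℂ) + t * I + 0))) with hV₂
  set V₁ : ℂ := (1 / (2 * π) : ℂ) * (∫ t : ℝ,
      U (1 - beta6 D + w + (((1 : ℝ) : ℂ) + t * I)) *
          χ.LFunction (1 - beta6 D + w + (((1 : ℝ) : ℂ) + t * I) + betaJ c' D (j + 1)) *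
          χ.LFunction (1 - beta6 D + w + (((1 : ℝ) : ℂ) + t * I) + betaJ c' D (j + 2)) /
          χ.LFunction (1 - beta6 D + w + (((1 : ℝ) : ℂ) + t * I)) *
        (((Y₁ : ℝ) : ℂ) ^ (((1 : ℝ) : ℂ) + t * I + 0) * omega1 (ell D ^ 30) (((1 : ℝ) : ℂ) + t * I + 0) /
          (((1 : ℝ) : ℂ) + t * I + 0))) with hV₁
  set A₂ : ℂ := (2 * π * I)⁻¹ * (∮ z in C(beta6 D - w, 3 * alpha D),
      U (1 - beta6 D + w + z) * χ.LFunction (1 - beta6 D + w + z + betaJ c' D (j + 1)) *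
          χ.LFunction (1 - beta6 D + w + z + betaJ c' D (j + 2)) /
          χ.LFunction (1 - beta6 D + w + z) *
        (((Y₂ : ℝ) : ℂ) ^ (z + 0) * omega1 (ell D ^ 30) (z + 0) / (z + 0))) with hA₂
  set A₁ : ℂ := (2 * π * I)⁻¹ * (∮ z in C(beta6 D - w, 3 * alpha D),
      U (1 - beta6 D + w + z) * χ.LFunction (1 - beta6 D + w + z + betaJ c' D (j + 1)) *
          χ.LFunction (1 - beta6 D + w + z + betaJ c' D (j + 2)) /
          χ.LFunction (1 - beta6 D + w + z) *
        (((Y₁ : ℝ) : ℂ) ^ (z + 0) * omega1 (ell D ^ 30) (z + 0) / (z + 0))) with hA₁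
  set M : ℂ := PiW χ d r * deriv χ.LFunction 1 *
      (betaJ c' D (j + 1) * betaJ c' D (j + 2) *
        ((((Y₂ : ℝ) : ℂ) ^ (beta6 D - w) - ((Y₁ : ℝ) : ℂ) ^ (beta6 D - w)) / (beta6 D - w))) with hM
  set hatPi : ℝ := ∏ q ∈ (d * r).primeFactors, (1 - (q : ℝ)⁻¹)⁻¹ with hhatPi
  -- the algebra
  have e : lineInt024 c' χ j d r w - deriv χ.LFunction 1 * PiW χ d r * circ025 c' D j d r w =
      (V₂ - A₂) - (V₁ - A₁) + ((A₂ - A₁) - M) := by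
    rw [hglue, h025', hM]
    ring
  rw [e]
  have hPi1 : 1 ≤ hatPi :=
    Literature.NumberTheory.Sieve.GreenTao2008.GYCorr.one_le_prod_one_sub_inv_inv (d * r)
  have hℓ15 : 0 ≤ (ell D ^ 15)⁻¹ := by positivity
  calc ‖(V₂ - A₂) - (V₁ - A₁) + ((A₂ - A₁) - M)‖
      ≤ ‖(V₂ - A₂) - (V₁ - A₁)‖ + ‖(A₂ - A₁) - M‖ := norm_add_le _ _
    _ ≤ (‖V₂ - A₂‖ + ‖V₁ - A₁‖) + ‖(A₂ - A₁) - M‖ := by gcongr; exact norm_sub_le _ _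
    _ ≤ (C₀ * (ell D ^ 15)⁻¹ + C₀ * (ell D ^ 15)⁻¹) + C₂ * (ell D ^ 15)⁻¹ * hatPi ^ 2 := by
        gcongr
    _ ≤ (2 * C₀ + C₂) * (ell D ^ 15)⁻¹ * hatPi ^ 2 := by
        have h1 : (1 : ℝ) ≤ hatPi ^ 2 := one_le_pow₀ hPi1
        have h2 : 0 ≤ C₀ * (ell D ^ 15)⁻¹ := by positivity
        nlinarith

/-! ## u026 (Cauchy's estimate) and (12.10)ᴿ at `𝓛⁻¹⁵` -/

section EdgesPow15

variable (c' : ℝ) {D : ℕ}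

/-- `α = π/𝓛⁹`. [cite: Zhang2022LandauSiegel, §2 (2.10)] -/
private theorem alpha_eq_div_u15 (D : ℕ) : alpha D = π / ell D ^ 9 := by
  rw [alpha, bigP, Real.log_exp]

/-- `α > 0` for `D ≥ 3`. [cite: Zhang2022LandauSiegel, §2 (2.10)] -/
private theorem alpha_pos_three_u15 (hD : 3 ≤ D) : 0 < alpha D := by
  rw [alpha_eq_div_u15]; exact div_pos Real.pi_pos (pow_pos (by linarith [one_lt_ell hD]) _)

/-- `log P₁ = 0.504·𝓛⁹`. [cite: Zhang2022LandauSiegel, §2 (2.21)] -/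
private theorem log_P1_eq_ell_u15 (D : ℕ) : Real.log (Skeleton.P1 D) = 0.504 * ell D ^ 9 := by
  rw [Skeleton.P1, Real.log_rpow (by rw [bigP]; exact Real.exp_pos _), bigP, Real.log_exp]


/-- `log P₁ > 0` for `D ≥ 3`. [cite: Zhang2022LandauSiegel, §2 (2.21)] -/
private theorem log_P1_pos_three_u15 (hD : 3 ≤ D) : 0 < Real.log (Skeleton.P1 D) := by
  rw [log_P1_eq_ell_u15]; exact mul_pos (by norm_num) (pow_pos (by linarith [one_lt_ell hD]) _)


/-- **Z22:§12.u026 (relative reading) from u024 + u025, all at (A)-exponent 15** (the THREAD `u026readRel_of_u024Rel_u025Rel` verbatim with every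
guard `AssumptionA D χ` replaced by `‖L(1,χ)‖ ≤ 𝓛⁻¹⁵`: Cauchy's estimate on `|w| = α`, constant `e^{521π}(|C₁|+|C₂|)/π`).
[cite: Zhang2022LandauSiegel, §12 proof of Lemma 12.2, pp. 69–70] -/
theorem u026readRel_pow15_of
    (h24 : ∃ C : ℝ, ForAllLarge fun D _ χ => ‖χ.LFunction 1‖ ≤ 1 / Real.log D ^ 15 →
      ∀ j ∈ ({1, 2, 3} : Finset ℕ), ∀ d r : ℕ, 1 ≤ d → 1 ≤ r →
        ((d * r : ℕ) : ℝ) ≤ P1pp D / bigT D → ∀ w : ℂ, ‖w‖ = alpha D →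
          ‖innerSum c' χ j d r w - gSeries c' χ j d r w‖ ≤
              C * (ell D ^ 15)⁻¹ * (∏ q ∈ (d * r).primeFactors, (1 - (q : ℝ)⁻¹)⁻¹) ^ 2 ∧
          ‖innerSum c' χ j d r w - lineInt024 c' χ j d r w‖ ≤
              C * (ell D ^ 15)⁻¹ * (∏ q ∈ (d * r).primeFactors, (1 - (q : ℝ)⁻¹)⁻¹) ^ 2)
    (h25 : ∃ C : ℝ, ForAllLarge fun D _ χ => ‖χ.LFunction 1‖ ≤ 1 / Real.log D ^ 15 →
      ∀ j ∈ ({1, 2, 3} : Finset ℕ), ∀ d r : ℕ, 1 ≤ d → 1 ≤ r →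
        ((d * r : ℕ) : ℝ) ≤ P1pp D / bigT D → ∀ w : ℂ, ‖w‖ = alpha D →
          ‖lineInt024 c' χ j d r w - deriv χ.LFunction 1 * PiW χ d r * circ025 c' D j d r w‖ ≤
            C * (ell D ^ 15)⁻¹ * (∏ q ∈ (d * r).primeFactors, (1 - (q : ℝ)⁻¹)⁻¹) ^ 2) :
    ∃ C : ℝ, ForAllLarge fun D _ χ => ‖χ.LFunction 1‖ ≤ 1 / Real.log D ^ 15 →
      ∀ j ∈ ({1, 2, 3} : Finset ℕ), ∀ d r : ℕ, 1 ≤ d → 1 ≤ r →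
        ((d * r : ℕ) : ℝ) ≤ P1pp D / bigT D →
          ‖deriv (bracket122 c' χ j d r) 0 -
              deriv χ.LFunction 1 * PiW χ d r * betaJ c' D (j + 1) * betaJ c' D (j + 2) *
                deriv (modelInt026 D) 0‖ ≤
            C * (ell D ^ 6)⁻¹ * (∏ q ∈ (d * r).primeFactors, (1 - (q : ℝ)⁻¹)⁻¹) ^ 2 := by
  obtain ⟨C₁, h24'⟩ := h24
  obtain ⟨C₂, h25'⟩ := h25
  obtain ⟨D₀, hall⟩ := (h24'.and h25').and (circ025_eq c')
  refine ⟨Real.exp (521 * π) * (|C₁| + |C₂|) / π, max D₀ 3,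
    fun D _ χ hD hq hp hA j hj d r hd hr h1 => ?_⟩
  have hD₀ : D₀ ≤ D := le_trans (le_max_left _ _) hD
  have hD3 : 3 ≤ D := le_trans (le_max_right _ _) hD
  obtain ⟨⟨k24, k25⟩, k25'⟩ := hall D χ hD₀ hq hp
  have hα : 0 < alpha D := alpha_pos_three_u15 hD3
  have hℓ : 0 < ell D := by linarith [one_lt_ell hD3]
  have hT : 1 ≤ bigT D := by rw [bigT]; exact Real.one_le_exp (by positivity)
  have h1' : ((d * r : ℕ) : ℝ) ≤ P1pp D := h1.trans (div_le_self (P1pp_pos hD3).le hT)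
  set R : ℝ := (∏ q ∈ (d * r).primeFactors, (1 - (q : ℝ)⁻¹)⁻¹) ^ 2 with hRdef
  have hR : 0 < R := lt_of_lt_of_le one_pos (Section8FrontEnd44ReductionRel.one_le_relFac _)
  set L : ℂ := deriv χ.LFunction 1 * PiW χ d r with hL
  set B : ℂ := betaJ c' D (j + 1) * betaJ c' D (j + 2) with hB
  set E : ℂ → ℂ := fun w => bracket122 c' χ j d r w - L * B * modelInt026 D w with hE
  -- the bound on the circle
  have hcirc : ∀ w ∈ Metric.sphere (0 : ℂ) (alpha D), ‖E w‖ ≤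
      Real.exp (521 * π) * ((|C₁| + |C₂|) * (ell D ^ 15)⁻¹ * R) := by
    intro w hw
    have hw' : ‖w‖ = alpha D := by simpa using hw
    have hwlt : ‖w‖ < 1.2 * alpha D := by rw [hw']; linarith
    obtain ⟨-, e24⟩ := k24 hA j hj d r hd hr h1 w hw'
    have e25 := k25 hA j hj d r hd hr h1 w hw'
    have e25' := k25' j hj d r hd hr w hw'
    have hid : E w = ((((d * r : ℕ) : ℝ) / P1pp D : ℝ) : ℂ) ^ (beta6 D - w) *
        (innerSum c' χ j d r w - L * circ025 c' D j d r w) := by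
      have key := Xpow_mul_closedForm025 c' hD3 j d r hd hr hwlt
      rw [← e25'] at key
      simp only [hE, bracket122]
      linear_combination L * key
    rw [hid, norm_mul]
    have h15 : 0 ≤ (ell D ^ 15)⁻¹ := inv_nonneg.mpr (pow_nonneg hℓ.le _)
    have hin : ‖innerSum c' χ j d r w - L * circ025 c' D j d r w‖ ≤
        (|C₁| + |C₂|) * (ell D ^ 15)⁻¹ * R := by
      calc ‖innerSum c' χ j d r w - L * circ025 c' D j d r w‖
          ≤ ‖innerSum c' χ j d r w - lineInt024 c' χ j d r w‖ +
              ‖lineInt024 c' χ j d r w - L * circ025 c' D j d r w‖ :=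
            norm_sub_le_norm_sub_add_norm_sub _ _ _
        _ ≤ C₁ * (ell D ^ 15)⁻¹ * R + C₂ * (ell D ^ 15)⁻¹ * R := add_le_add e24 e25
        _ ≤ |C₁| * (ell D ^ 15)⁻¹ * R + |C₂| * (ell D ^ 15)⁻¹ * R := by
            gcongr <;> exact le_abs_self _
        _ = (|C₁| + |C₂|) * (ell D ^ 15)⁻¹ * R := by ring
    exact mul_le_mul (norm_Xpow_le_small hD3 d r hd hr h1' hw') hin (norm_nonneg _)
      (Real.exp_pos _).le
  -- holomorphy on a neighbourhood of the closed disc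
  have hdiff : DiffContOnCl ℂ E (Metric.ball (0 : ℂ) (alpha D)) := by
    have hsub : Metric.closedBall (0 : ℂ) (alpha D) ⊆ Metric.ball (0 : ℂ) (1.2 * alpha D) :=
      Metric.closedBall_subset_ball (by linarith)
    refine DifferentiableOn.diffContOnCl_ball (U := Metric.ball (0 : ℂ) (1.2 * alpha D)) ?_ hsub
    exact ((differentiable_bracket122 c' χ hD3 j d r hd hr).differentiableOn).sub
      ((differentiableOn_modelInt026 hD3).const_mul _)
  have hderiv := Complex.norm_deriv_le_of_forall_mem_sphere_norm_le hα hdiff hcirc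
  -- split the derivative
  have hBr : DifferentiableAt ℂ (bracket122 c' χ j d r) 0 :=
    (differentiable_bracket122 c' χ hD3 j d r hd hr) 0
  have hM : DifferentiableAt ℂ (modelInt026 D) 0 :=
    (differentiableOn_modelInt026 hD3).differentiableAt
      (Metric.isOpen_ball.mem_nhds (Metric.mem_ball_self (by positivity)))
  have hsplit : deriv E 0 = deriv (bracket122 c' χ j d r) 0 - L * B * deriv (modelInt026 D) 0 := by
    simp only [hE]
    rw [deriv_fun_sub hBr (hM.const_mul _), deriv_const_mul _ hM]
  rw [hsplit, hL, hB] at hderiv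
  have hrw : deriv χ.LFunction 1 * PiW χ d r * (betaJ c' D (j + 1) * betaJ c' D (j + 2)) *
      deriv (modelInt026 D) 0 =
      deriv χ.LFunction 1 * PiW χ d r * betaJ c' D (j + 1) * betaJ c' D (j + 2) *
        deriv (modelInt026 D) 0 := by ring
  rw [hrw] at hderiv
  refine hderiv.trans (le_of_eq ?_)
  rw [alpha_eq_div_u15]
  have h9 : ell D ^ 9 ≠ 0 := pow_ne_zero _ hℓ.ne'
  have h15 : ell D ^ 15 ≠ 0 := pow_ne_zero _ hℓ.ne'
  have h6 : ell D ^ 6 ≠ 0 := pow_ne_zero _ hℓ.ne'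
  have hπ : (π : ℝ) ≠ 0 := Real.pi_ne_zero
  field_simp

/-- **Z22:(12.10) (relative reading, rate `O(𝓛⁻¹⁵)`) from u026, both at (A)-exponent 15** (the THREAD `eq1210L15Rel_of_u026readRel` verbatim,
guard swapped: u023, u027, `b*`, `log P₁ = 0.504 log P`). [cite: Zhang2022LandauSiegel, §12 (12.10) pp. 69–70] -/
theorem eq1210L15Rel_pow15_of_u026readRel
    (h26 : ∃ C : ℝ, ForAllLarge fun D _ χ => ‖χ.LFunction 1‖ ≤ 1 / Real.log D ^ 15 →
      ∀ j ∈ ({1, 2, 3} : Finset ℕ), ∀ d r : ℕ, 1 ≤ d → 1 ≤ r →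
        ((d * r : ℕ) : ℝ) ≤ P1pp D / bigT D →
          ‖deriv (bracket122 c' χ j d r) 0 -
              deriv χ.LFunction 1 * PiW χ d r * betaJ c' D (j + 1) * betaJ c' D (j + 2) *
                deriv (modelInt026 D) 0‖ ≤
            C * (ell D ^ 6)⁻¹ * (∏ q ∈ (d * r).primeFactors, (1 - (q : ℝ)⁻¹)⁻¹) ^ 2) :
    ∃ C : ℝ, ForAllLarge fun D _ χ => ‖χ.LFunction 1‖ ≤ 1 / Real.log D ^ 15 →
      ∀ j ∈ ({1, 2, 3} : Finset ℕ), ∀ d r : ℕ, 1 ≤ d → 1 ≤ r →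
        ((d * r : ℕ) : ℝ) ≤ P1pp D / bigT D →
          ‖sum122 c' χ j d r - main1210 c' χ j d r‖ ≤
            C * (ell D ^ 15)⁻¹ * (∏ q ∈ (d * r).primeFactors, (1 - (q : ℝ)⁻¹)⁻¹) ^ 2 := by
  obtain ⟨C, h26'⟩ := h26
  obtain ⟨D₀, hall⟩ := ((U023_holds c').and h26').and U027_holds
  refine ⟨C / 0.504, max D₀ 3, fun D _ χ hD hq hp hA j hj d r hd hr h1 => ?_⟩
  have hD₀ : D₀ ≤ D := le_trans (le_max_left _ _) hD
  have hD3 : 3 ≤ D := le_trans (le_max_right _ _) hD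
  obtain ⟨⟨k23, k26⟩, k27⟩ := hall D χ hD₀ hq hp
  have e23 := k23 j hj d r hd hr
  have e26 := k26 hA j hj d r hd hr h1
  have hℓ : 0 < ell D := by linarith [one_lt_ell hD3]
  have hlogPeq : Real.log (bigP D) = ell D ^ 9 := by rw [bigP, Real.log_exp]
  have hlogP : 0 < Real.log (bigP D) := by rw [hlogPeq]; exact pow_pos hℓ _
  have hlogP1 : 0 < Real.log (Skeleton.P1 D) := log_P1_pos_three_u15 hD3
  have hlogc : (Real.log (Skeleton.P1 D) : ℂ) ≠ 0 := by exact_mod_cast hlogP1.ne'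
  have hlogPc : (Real.log (bigP D) : ℂ) ≠ 0 := by exact_mod_cast hlogP.ne'
  set R : ℝ := (∏ q ∈ (d * r).primeFactors, (1 - (q : ℝ)⁻¹)⁻¹) ^ 2 with hRdef
  set L : ℂ := deriv χ.LFunction 1 * PiW χ d r with hL
  -- the main term: −(1/log P₁)·L·β'β''·(deriv modelInt026 0) = main1210
  have hmain : -(1 / (Real.log (Skeleton.P1 D) : ℂ)) *
      (L * betaJ c' D (j + 1) * betaJ c' D (j + 2) * deriv (modelInt026 D) 0) =
        main1210 c' χ j d r := by
    rw [k27, main1210, bstar_eq_display, hL]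
    set J : ℂ := ∫ z in (0 : ℝ)..0.004, (z : ℂ) * cexp (3 * π * I * z / 2) with hJ
    have hP1c : (Real.log (Skeleton.P1 D) : ℂ) = 0.504 * (Real.log (bigP D) : ℂ) := by
      rw [log_P1_eq_ell_u15, hlogPeq]; push_cast; ring
    rw [hP1c]
    push_cast
    field_simp
  have hid : sum122 c' χ j d r - main1210 c' χ j d r =
      -(1 / (Real.log (Skeleton.P1 D) : ℂ)) *
        (deriv (bracket122 c' χ j d r) 0 -
          L * betaJ c' D (j + 1) * betaJ c' D (j + 2) * deriv (modelInt026 D) 0) := by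
    rw [e23, ← hmain]; ring
  rw [hid, norm_mul, norm_neg, norm_div, norm_one, Complex.norm_real, Real.norm_eq_abs,
    abs_of_pos hlogP1]
  have hval : 1 / Real.log (Skeleton.P1 D) * (C * (ell D ^ 6)⁻¹ * R) =
      C / 0.504 * (ell D ^ 15)⁻¹ * R := by
    rw [log_P1_eq_ell_u15]
    have h9 : ell D ^ 9 ≠ 0 := pow_ne_zero _ hℓ.ne'
    have h6 : ell D ^ 6 ≠ 0 := pow_ne_zero _ hℓ.ne'
    have h15 : ell D ^ 15 ≠ 0 := pow_ne_zero _ hℓ.ne'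
    field_simp
  calc 1 / Real.log (Skeleton.P1 D) *
        ‖deriv (bracket122 c' χ j d r) 0 -
          L * betaJ c' D (j + 1) * betaJ c' D (j + 2) * deriv (modelInt026 D) 0‖
      ≤ 1 / Real.log (Skeleton.P1 D) * (C * (ell D ^ 6)⁻¹ * R) :=
        mul_le_mul_of_nonneg_left e26 (by positivity)
    _ = C / 0.504 * (ell D ^ 15)⁻¹ * R := hval

end EdgesPow15

/-- **Z22:(12.10) in the relative reading at (A)-exponent 15, UNCONDITIONAL, every real `c′`** — the body of `Typed.Sec12B.Eq1210L15Rel c′`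
(the input `h10R` of `Typed.Sec12C.eq1212_of_eq1210L15Rel'`) with its guard `AssumptionA D χ` replaced by `‖L(1,χ)‖ ≤ 𝓛⁻¹⁵`:
`eq1210L15Rel_pow15_of_u026readRel (u026readRel_pow15_of (u024Rel_pow15 c′) (u025Rel_pow15 c′))`. [cite: Zhang2022LandauSiegel, §12 (12.10) pp. 69–70] -/
theorem eq1210L15Rel_pow15 (c' : ℝ) :
    ∃ C : ℝ, ForAllLarge fun D _ χ => ‖χ.LFunction 1‖ ≤ 1 / Real.log D ^ 15 →
      ∀ j ∈ ({1, 2, 3} : Finset ℕ), ∀ d r : ℕ, 1 ≤ d → 1 ≤ r →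
        ((d * r : ℕ) : ℝ) ≤ P1pp D / bigT D →
          ‖sum122 c' χ j d r - main1210 c' χ j d r‖ ≤
            C * (ell D ^ 15)⁻¹ * (∏ q ∈ (d * r).primeFactors, (1 - (q : ℝ)⁻¹)⁻¹) ^ 2 :=
  eq1210L15Rel_pow15_of_u026readRel c' (u026readRel_pow15_of c' (u024Rel_pow15 c') (u025Rel_pow15 c'))

/-- **(12.10)ᴿ under `Repair.Bed.AssumptionAWith E`, every real `E ≥ 15`** (transfer; at `E = 2022` the body of the tree theorem
`eq1210L15Rel_holds`). [cite: Zhang2022LandauSiegel, §12 (12.10) pp. 69–70] -/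
theorem eq1210L15Rel_of_assumptionAWith (c' : ℝ) {E : ℝ} (hE : 15 ≤ E) :
    ∃ C : ℝ, ForAllLarge fun D _ χ => Repair.Bed.AssumptionAWith E D χ →
      ∀ j ∈ ({1, 2, 3} : Finset ℕ), ∀ d r : ℕ, 1 ≤ d → 1 ≤ r →
        ((d * r : ℕ) : ℝ) ≤ P1pp D / bigT D →
          ‖sum122 c' χ j d r - main1210 c' χ j d r‖ ≤
            C * (ell D ^ 15)⁻¹ * (∏ q ∈ (d * r).primeFactors, (1 - (q : ℝ)⁻¹)⁻¹) ^ 2 := by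
  obtain ⟨C, h⟩ := eq1210L15Rel_pow15 c'
  exact ⟨C, Repair.Gap.forAllLarge_assumptionAWith_of_pow15 hE h⟩

end Literature.NumberTheory.LFunctions.Zhang2022.Typed.Sec12B

end
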